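import Mathlib
import Literature.Probability.LatticeModels.SCTWardIdentity
import Summits.CriticalPhenomena.Ising3DConformalLimit.Theorems.PrecisionLaplacianMoebiusLimitOfTwoPointLawWeakDilation
import HarnessLib

/-!
# Stub C1 `stub_ward_of_pointwise` for crux `MoebiusLimitExists` (stmt-CriticalPhenomena-1344), line `Sketch` v13
(lead prover-line-stmt-CriticalPhenomena-1344-c18-0; THEOREM-ONLY, `--supports stmt-CriticalPhenomena-1344`)

Pointwise special-conformal identity on an open set where the level is real-analytic ⇒ the weak `K_b` Ward identity for tests
compactly supported there (integration by parts; `div K_b = −6 Σᵢ ⟪b, xᵢ⟫` on `(ℝ³)ⁿ`).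

Let `U ⊆ (ℝ³)ⁿ = Fin n → EuclideanSpace ℝ (Fin 3)` be open, `F` real-analytic on `U` with
`DF(x)[K(x)] = 2Δ σ_b(x) F(x)` on `U`, where `K(x) = (K_b(xᵢ))ᵢ`, `K_b(y) = ‖y‖² b − 2⟪b,y⟫ y`,
`σ_b(x) = Σᵢ ⟪b, xᵢ⟫`. For a smooth `φ` compactly supported in `U` we show
`∫ F [(2Δ − 6) σ_b φ + Dφ[K]] = 0`. Proof: expand `K(x) = Σ_{(i,μ)} c_{iμ}(x) e_{iμ}` over the
coordinate directions `e_{iμ}` (`c_{iμ}(x) = ‖xᵢ‖² b_μ − 2⟪b,xᵢ⟫ x_{iμ}`), integrate by parts in each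
CONSTANT direction `e_{iμ}` (Mathlib's `integral_bilinear_hasFDerivAt_right_eq_neg_left_of_integrable`
for `f = F c_{iμ}`, `g = φ`), and sum: `Σ ∂_{iμ}(F c_{iμ}) = DF[K] + F div K = DF[K] − 6 σ_b F`, and the
pointwise identity turns this into `(2Δ − 6) σ_b F`, which cancels the zeroth-order term.

Integrability of the pairings: all integrands are `(function continuous on U) × (continuous
function vanishing off tsupport φ)`, handled by the tree lemma `integrable_mul_of_eq_zero_off_tsupport`
(`…PrecisionLaplacianMoebiusLimitOfTwoPointLawWeakDilation`); `F` is arbitrary off `U`.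

References: Di Francesco–Mathieu–Sénéchal, *Conformal Field Theory* (1997) §4.3.1 (4.51)–(4.54)
[FrancescoMathieuSenechal1997]; the field `K_b` and `div K_b = −2d⟪b,·⟫` are
`Literature.Probability.LatticeModels.sctField` / `trace_fderiv_sctField`.
-/

noncomputable section

open Set Function MeasureTheory Filter Topology
open Literature.Probability.LatticeModels
open Summit.CriticalPhenomena.Ising3DConformalLimit.PrecisionLaplacianMoebiusLimitOfTwoPointLaw
  (integrable_mul_of_eq_zero_off_tsupport)

namespace Summit.CriticalPhenomena.Ising3DConformalLimit.MoebiusLimitExistsSketchV13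

/-! ## Auxiliary lemmas -/

/-- Coordinates in `ℝ³`: `v = Σ_μ v_μ e_μ` with `e_μ = EuclideanSpace.single μ 1`. [folklore] -/
theorem wardOfPointwise_euclidean_decomp (v : EuclideanSpace ℝ (Fin 3)) :
    v = ∑ μ, v μ • EuclideanSpace.single μ (1 : ℝ) := by
  conv_lhs => rw [← (EuclideanSpace.basisFun (Fin 3) ℝ).sum_repr' v]
  refine Finset.sum_congr rfl fun μ _ => ?_
  rw [EuclideanSpace.basisFun_apply, EuclideanSpace.inner_single_left]
  simp

/-- The configuration field `K(x) = (‖xᵢ‖² b − 2⟪b,xᵢ⟫ xᵢ)ᵢ` on `(ℝ³)ⁿ` expanded over the coordinate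
directions `e_{iμ} = Pi.single i (EuclideanSpace.single μ 1)`:
`K(x) = Σ_{(i,μ)} (‖xᵢ‖² b_μ − 2⟪b,xᵢ⟫ x_{iμ}) e_{iμ}`. [folklore] -/
theorem wardOfPointwise_field_decomp {n : ℕ} (b : EuclideanSpace ℝ (Fin 3))
    (x : Fin n → EuclideanSpace ℝ (Fin 3)) :
    (fun i => ‖x i‖ ^ 2 • b - (2 * inner ℝ b (x i)) • x i) =
      ∑ k : Fin n × Fin 3, (‖x k.1‖ ^ 2 * b k.2 - 2 * inner ℝ b (x k.1) * x k.1 k.2) •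
        (Pi.single k.1 (EuclideanSpace.single k.2 (1 : ℝ)) : Fin n → EuclideanSpace ℝ (Fin 3)) := by
  funext j
  rw [Finset.sum_apply, Fintype.sum_prod_type, Finset.sum_comm]
  simp only [Pi.smul_apply, Pi.single_apply, smul_ite, smul_zero, Finset.sum_ite_eq,
    Finset.mem_univ, if_true]
  conv_lhs => rw [wardOfPointwise_euclidean_decomp (‖x j‖ ^ 2 • b - (2 * inner ℝ b (x j)) • x j)]
  refine Finset.sum_congr rfl fun μ _ => ?_
  simp only [PiLp.sub_apply, PiLp.smul_apply, smul_eq_mul]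

/-- The coefficient `c_{iμ}(y) = ‖yᵢ‖² b_μ − 2⟪b,yᵢ⟫ y_{iμ}` of the configuration field is
differentiable, with directional derivative `−2⟪b, xᵢ⟫` along `e_{iμ}` at `x` (so that
`Σ_μ ∂_{iμ} c_{iμ} = −6⟪b,xᵢ⟫ = div K_b (xᵢ)`). [folklore] -/
theorem wardOfPointwise_hasFDerivAt_coeff {n : ℕ} (b : EuclideanSpace ℝ (Fin 3)) (i : Fin n)
    (μ : Fin 3) (x : Fin n → EuclideanSpace ℝ (Fin 3)) :
    ∃ L : (Fin n → EuclideanSpace ℝ (Fin 3)) →L[ℝ] ℝ,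
      HasFDerivAt (fun y : Fin n → EuclideanSpace ℝ (Fin 3) =>
          ‖y i‖ ^ 2 * b μ - 2 * inner ℝ b (y i) * y i μ) L x ∧
        L (Pi.single i (EuclideanSpace.single μ (1 : ℝ))) = -2 * inner ℝ b (x i) := by
  have hP : HasFDerivAt (fun y : Fin n → EuclideanSpace ℝ (Fin 3) => y i)
      (ContinuousLinearMap.proj i) x := hasFDerivAt_apply (𝕜 := ℝ) i x
  have h2 : HasFDerivAt (fun y : Fin n → EuclideanSpace ℝ (Fin 3) => inner ℝ b (y i))
      ((innerSL ℝ b).comp (ContinuousLinearMap.proj i)) x :=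
    (innerSL ℝ b).hasFDerivAt.comp x hP
  have h3 : HasFDerivAt (fun y : Fin n → EuclideanSpace ℝ (Fin 3) => (y i μ : ℝ))
      ((PiLp.proj 2 (fun _ : Fin 3 => ℝ) μ).comp (ContinuousLinearMap.proj (R := ℝ) i)) x :=
    ((PiLp.hasFDerivAt_apply (𝕜 := ℝ) 2 (x i) μ).comp x hP :)
  refine ⟨_, (hP.norm_sq.mul_const (b μ)).sub ((h2.const_mul 2).mul h3), ?_⟩
  simp [EuclideanSpace.inner_single_right]
  ring

/-! ## The stub -/

/-- **Stub C1 — `stub_ward_of_pointwise`** (registered signature). On an open `U ⊆ (ℝ³)ⁿ` where the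
level `F` is real-analytic, the pointwise special-conformal identity `DF(x)[K(x)] = 2Δ σ_b(x) F(x)`
implies the weak Ward identity `∫ F [(2Δ − 6) σ_b φ + Dφ[K]] = 0` for every smooth `φ` compactly
supported in `U`: integrate by parts along each coordinate direction after expanding `K` in
coordinates, and use `div K = −6 σ_b`. [cite: FrancescoMathieuSenechal1997, §4.3.1 (4.51)–(4.54)] -/
theorem stub_ward_of_pointwise : ∀ (n : ℕ) (F : (Fin n → EuclideanSpace ℝ (Fin 3)) → ℝ) (Δ : ℝ)
    (b : EuclideanSpace ℝ (Fin 3)) (U : Set (Fin n → EuclideanSpace ℝ (Fin 3))), IsOpen U → AnalyticOnNhd ℝ F U →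
    (∀ x ∈ U, fderiv ℝ F x (fun i => ‖x i‖ ^ 2 • b - (2 * inner ℝ b (x i)) • x i) =
      2 * Δ * (∑ i, inner ℝ b (x i)) * F x) →
    ∀ (φ : (Fin n → EuclideanSpace ℝ (Fin 3)) → ℝ),
      ContDiff ℝ ((⊤ : ℕ∞) : WithTop ℕ∞) φ → HasCompactSupport φ → tsupport φ ⊆ U →
      ∫ x, F x * ((2 * Δ - 6) * (∑ i, inner ℝ b (x i)) * φ x +
        fderiv ℝ φ x (fun i => ‖x i‖ ^ 2 • b - (2 * inner ℝ b (x i)) • x i)) = 0 := by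
  intro n F Δ b U hU hF hW φ hφ hφc hφU
  -- derivatives `L k x` of the coefficients `c k`, coordinate directions `e k`
  choose L hcL hLe using fun (k : Fin n × Fin 3) (x : Fin n → EuclideanSpace ℝ (Fin 3)) =>
    wardOfPointwise_hasFDerivAt_coeff b k.1 k.2 x
  set e : Fin n × Fin 3 → (Fin n → EuclideanSpace ℝ (Fin 3)) := fun k =>
    Pi.single k.1 (EuclideanSpace.single k.2 (1 : ℝ)) with he
  set c : Fin n × Fin 3 → (Fin n → EuclideanSpace ℝ (Fin 3)) → ℝ := fun k x =>
    ‖x k.1‖ ^ 2 * b k.2 - 2 * inner ℝ b (x k.1) * x k.1 k.2 with hc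
  have hK : ∀ x : Fin n → EuclideanSpace ℝ (Fin 3),
      (fun i => ‖x i‖ ^ 2 • b - (2 * inner ℝ b (x i)) • x i) = ∑ k, c k x • e k :=
    fun x => wardOfPointwise_field_decomp b x
  have hsumL : ∀ x : Fin n → EuclideanSpace ℝ (Fin 3),
      ∑ k, L k x (e k) = -6 * ∑ i, inner ℝ b (x i) := by
    intro x
    simp only [he, hLe]
    rw [Fintype.sum_prod_type, Finset.mul_sum]
    refine Finset.sum_congr rfl fun i _ => ?_
    simp only [Finset.sum_const, Finset.card_univ, Fintype.card_fin, nsmul_eq_mul, Nat.cast_ofNat]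
    ring
  -- regularity
  have hFc : ContinuousOn F U := hF.continuousOn
  have hF'c : ContinuousOn (fderiv ℝ F) U := hF.fderiv.continuousOn
  have hφ' : Continuous (fderiv ℝ φ) := hφ.continuous_fderiv (by simp)
  have hφd : ∀ x, HasFDerivAt φ (fderiv ℝ φ x) x := fun x =>
    (hφ.differentiable (by simp) x).hasFDerivAt
  have hcc : ∀ k, Continuous (c k) := fun k => by
    simp only [hc]
    fun_prop
  have hLc : ∀ k, Continuous fun x => L k x (e k) := fun k => by
    have h : (fun x => L k x (e k)) = fun x => -2 * inner ℝ b (x k.1) := funext fun x => hLe k x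
    rw [h]
    fun_prop
  -- the product rule for `F * c k` on `tsupport φ ⊆ U`
  have hFck : ∀ k, ∀ x ∈ tsupport φ,
      HasFDerivAt (fun y => F y * c k y) (F x • L k x + c k x • fderiv ℝ F x) x :=
    fun k x hx => ((hF x (hφU hx)).differentiableAt.hasFDerivAt).mul (hcL k x)
  -- integrability of the three pairings
  have hIA : ∀ k, Integrable (fun x => F x * c k x * fderiv ℝ φ x (e k)) := fun k =>
    integrable_mul_of_eq_zero_off_tsupport (hFc.mul (hcc k).continuousOn) hU hφc hφU
      (hφ'.clm_apply continuous_const) fun x hx => by simp [fderiv_of_notMem_tsupport ℝ hx]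
  have hIfg : ∀ k, Integrable (fun x => F x * c k x * φ x) := fun k =>
    integrable_mul_of_eq_zero_off_tsupport (hFc.mul (hcc k).continuousOn) hU hφc hφU hφ.continuous
      fun x hx => image_eq_zero_of_notMem_tsupport hx
  have hID : ∀ k, Integrable
      (fun x => (F x * L k x (e k) + c k x * fderiv ℝ F x (e k)) * φ x) := fun k =>
    integrable_mul_of_eq_zero_off_tsupport
      ((hFc.mul (hLc k).continuousOn).add
        ((hcc k).continuousOn.mul (hF'c.clm_apply continuousOn_const)))
      hU hφc hφU hφ.continuous fun x hx => image_eq_zero_of_notMem_tsupport hx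
  -- integration by parts in the constant direction `e k`
  have hIBP : ∀ k, ∫ x, F x * c k x * fderiv ℝ φ x (e k) =
      -∫ x, (F x * L k x (e k) + c k x * fderiv ℝ F x (e k)) * φ x := by
    intro k
    have h := integral_bilinear_hasFDerivAt_right_eq_neg_left_of_integrable (μ := volume)
      (B := ContinuousLinearMap.mul ℝ ℝ) (f := fun x => F x * c k x)
      (f' := fun x => F x • L k x + c k x • fderiv ℝ F x) (g := φ) (g' := fderiv ℝ φ) (v := e k)
      (by simpa only [ContinuousLinearMap.mul_apply', add_apply, FunLike.coe_smul,
        Pi.smul_apply, smul_eq_mul] using hID k)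
      (by simpa only [ContinuousLinearMap.mul_apply'] using hIA k)
      (by simpa only [ContinuousLinearMap.mul_apply'] using hIfg k)
      (hFck k) (fun x _ => hφd x)
    simpa only [ContinuousLinearMap.mul_apply', add_apply, FunLike.coe_smul, Pi.smul_apply,
      smul_eq_mul] using h
  -- the pointwise rearrangement of the integrand
  have hP : ∀ x : Fin n → EuclideanSpace ℝ (Fin 3),
      F x * ((2 * Δ - 6) * (∑ i, inner ℝ b (x i)) * φ x +
          fderiv ℝ φ x (fun i => ‖x i‖ ^ 2 • b - (2 * inner ℝ b (x i)) • x i)) =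
        ∑ k, (F x * c k x * fderiv ℝ φ x (e k) +
          (F x * L k x (e k) + c k x * fderiv ℝ F x (e k)) * φ x) := by
    intro x
    by_cases hx : x ∈ tsupport φ
    · have h1 : fderiv ℝ φ x (fun i => ‖x i‖ ^ 2 • b - (2 * inner ℝ b (x i)) • x i) =
          ∑ k, c k x * fderiv ℝ φ x (e k) := by
        rw [hK x, map_sum]
        simp only [map_smul, smul_eq_mul]
      have h2 : fderiv ℝ F x (fun i => ‖x i‖ ^ 2 • b - (2 * inner ℝ b (x i)) • x i) =
          ∑ k, c k x * fderiv ℝ F x (e k) := by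
        rw [hK x, map_sum]
        simp only [map_smul, smul_eq_mul]
      have h3 := hW x (hφU hx)
      have hsplit : ∀ k, F x * c k x * fderiv ℝ φ x (e k) +
          (F x * L k x (e k) + c k x * fderiv ℝ F x (e k)) * φ x =
          F x * (c k x * fderiv ℝ φ x (e k)) + F x * φ x * L k x (e k) +
            φ x * (c k x * fderiv ℝ F x (e k)) := fun k => by ring
      rw [Finset.sum_congr rfl fun k _ => hsplit k, Finset.sum_add_distrib, Finset.sum_add_distrib,
        ← Finset.mul_sum, ← Finset.mul_sum, ← Finset.mul_sum, ← h1, ← h2, hsumL x, h3]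
      ring
    · simp [image_eq_zero_of_notMem_tsupport hx, fderiv_of_notMem_tsupport ℝ hx]
  -- conclusion: `∫ Σ_k (A_k + D_k) = Σ_k (∫ A_k + ∫ D_k) = 0`
  calc ∫ x, F x * ((2 * Δ - 6) * (∑ i, inner ℝ b (x i)) * φ x +
          fderiv ℝ φ x (fun i => ‖x i‖ ^ 2 • b - (2 * inner ℝ b (x i)) • x i))
      = ∫ x, ∑ k, (F x * c k x * fderiv ℝ φ x (e k) +
          (F x * L k x (e k) + c k x * fderiv ℝ F x (e k)) * φ x) :=
        integral_congr_ae (Eventually.of_forall hP)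
    _ = ∑ k, ∫ x, (F x * c k x * fderiv ℝ φ x (e k) +
          (F x * L k x (e k) + c k x * fderiv ℝ F x (e k)) * φ x) :=
        integral_finsetSum _ fun k _ => (hIA k).add (hID k)
    _ = ∑ k, ((∫ x, F x * c k x * fderiv ℝ φ x (e k)) +
          ∫ x, (F x * L k x (e k) + c k x * fderiv ℝ F x (e k)) * φ x) :=
        Finset.sum_congr rfl fun k _ => integral_add (hIA k) (hID k)
    _ = 0 := Finset.sum_eq_zero fun k _ => by rw [hIBP k]; ring

end Summit.CriticalPhenomena.Ising3DConformalLimit.MoebiusLimitExistsSketchV13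

end
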